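import Summits.HodgeConjecture.HodgeCM.PerL34.ArchCOrbit_2

/-! PORT of `HodgeCM/PerL34/ArchCOrbit.lean` (HodgeCMPerL run 82) — part 3: continuation of `Summits.HodgeConjecture.HodgeCM.PerL34.ArchCOrbit_2` (split at a top-level declaration boundary by port_pkg.py; scope re-opened below; declarations unchanged). -/

-- port_pkg: scope re-opened for this part (file-level context, then the namespace/section stack open at the cut)
set_option autoImplicit false
noncomputable section
namespace HodgeCM
namespace PerL34
namespace ArchC
open HodgeCM.Prior.Perl34File HodgeCM.Prior.Perl34File.Perl34
section Bridge
open HodgeCM.PerL34.Fock HodgeCM.PerL34.Fock.PrintDict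
variable {H HG CG G SK SigIdx SigIdxG : Type*}
variable [NormedAddCommGroup H] [InnerProductSpace ℂ H] [CompleteSpace H]
variable [NormedAddCommGroup HG] [InnerProductSpace ℂ HG] [CompleteSpace HG]
variable [NormedAddCommGroup CG] [NormedSpace ℂ CG]
variable [Group G] [TopologicalSpace G] [TopologicalSpace SK]
namespace PrintedOrbitSide
variable {C : IsolationCore H HG CG G SK SigIdx SigIdxG} {D : TorusData C} {P : C4a.PointedCore C}
variable {RP : Type} [Fintype RP] [DecidableEq RP] {kind : RP → PlaceKind} {lam : RP → ℂ} {hlam : ∀ b, lam b ≠ 0}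
  {vac : RP → (Circle × Circle →* Circle)}
/-- **The D7-free bridge from the printed side**: `pl := printPlaces`, `w := printPlacesW` (KERNEL `w_norm`, `w_loc`,
pv12-g7). -/
def toOrbitBridge (A : PrintedOrbitSide C D P RP kind lam hlam vac) : FockOrbitBridge C D P :=
  letI : AddCommGroup SK := A.instSKacg
  letI : Module ℂ SK := A.instSKmod
  { pl := printPlaces RP kind lam hlam vac
    ιT := A.ιT
    w := printPlacesW RP kind lam hlam vac
    w_norm := printPlacesW_norm RP kind lam hlam vac
    w_loc := printPlacesW_loc RP kind lam hlam vac
    instSKacg := A.instSKacg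
    instSKmod := A.instSKmod
    TΦc_add := A.TΦc_add
    TΦc_smul := A.TΦc_smul
    cont := A.cont
    FinIdx := A.FinIdx
    ins := A.ins
    dense := A.dense
    omg_ins := A.omg_ins
    invariance := A.invariance
    ιR := A.ιR
    XR := A.XR
    e := A.e
    ladder_span := A.ladder_span
    hF := A.hF
    wOccurs_of_eigenvector := A.wOccurs_of_eigenvector }

/-- Read-backs (`rfl`). -/
theorem toOrbitBridge_pl (A : PrintedOrbitSide C D P RP kind lam hlam vac) :
    A.toOrbitBridge.pl = printPlaces RP kind lam hlam vac := rfl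

/-- (Ported verbatim from the HodgeCMPerL package; no docstring in the source.) -/
theorem toOrbitBridge_w (A : PrintedOrbitSide C D P RP kind lam hlam vac) :
    A.toOrbitBridge.w = printPlacesW RP kind lam hlam vac := rfl

/-- (Ported verbatim from the HodgeCMPerL package; no docstring in the source.) -/
theorem toOrbitBridge_toOrbitCore_φ₀ (A : PrintedOrbitSide C D P RP kind lam hlam vac) :
    A.toOrbitBridge.toOrbitCore.φ₀ = (printPlaces RP kind lam hlam vac).φ₀ := rfl

/-- **Lemma 4.1(c) over the printed places, D7-free.** -/
theorem H_occ (A : PrintedOrbitSide C D P RP kind lam hlam vac) :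
    ∀ (Φ : SK) (i : SigIdx), (∃ v ∈ C.hatσ i, C.TΦ Φ v ≠ 0) → D.wOccurs i :=
  A.toOrbitBridge.H_occ

end PrintedOrbitSide

/-- **Old printed side ⇒ new printed side** (forget the seven Gårding-side fields; named under THIS file's record,
not in pv12-g7's `PrintedAnalyticSide.*` dot-namespace, by request). -/
def PrintedOrbitSide.ofAnalytic {C : IsolationCore H HG CG G SK SigIdx SigIdxG} {D : TorusData C}
    {P : C4a.PointedCore C} {RP : Type} [Fintype RP] [DecidableEq RP] {kind : RP → PlaceKind} {lam : RP → ℂ}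
    {hlam : ∀ b, lam b ≠ 0} {vac : RP → (Circle × Circle →* Circle)}
    (A : PrintedAnalyticSide C D P RP kind lam hlam vac) : PrintedOrbitSide C D P RP kind lam hlam vac where
  ιT := A.ιT
  instSKacg := A.instSKacg
  instSKmod := A.instSKmod
  TΦc_add := A.TΦc_add
  TΦc_smul := A.TΦc_smul
  cont := A.cont
  FinIdx := A.FinIdx
  ins := A.ins
  dense := A.dense
  omg_ins := A.omg_ins
  invariance := A.invariance
  ιR := A.ιR
  XR := A.XR
  e := A.e
  ladder_span := A.ladder_span
  hF := A.hF
  wOccurs_of_eigenvector := A.wOccurs_of_eigenvector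

/-- The forgetful maps commute with the bridge constructions on the observable data (`rfl`). -/
theorem PrintedOrbitSide.ofAnalytic_toOrbitBridge_pl {C : IsolationCore H HG CG G SK SigIdx SigIdxG}
    {D : TorusData C} {P : C4a.PointedCore C} {RP : Type} [Fintype RP] [DecidableEq RP] {kind : RP → PlaceKind}
    {lam : RP → ℂ} {hlam : ∀ b, lam b ≠ 0} {vac : RP → (Circle × Circle →* Circle)}
    (A : PrintedAnalyticSide C D P RP kind lam hlam vac) :
    (PrintedOrbitSide.ofAnalytic A).toOrbitBridge.pl = (FockOrbitBridge.ofAnalytic A.toBridge).pl ∧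
      (PrintedOrbitSide.ofAnalytic A).toOrbitBridge.w = (FockOrbitBridge.ofAnalytic A.toBridge).w :=
  ⟨rfl, rfl⟩

/-- The composite old printed side ⇒ new printed side ⇒ `H_occ` is the old conclusion verbatim. -/
theorem PrintedOrbitSide.H_occ_ofAnalytic {C : IsolationCore H HG CG G SK SigIdx SigIdxG}
    {D : TorusData C} {P : C4a.PointedCore C} {RP : Type} [Fintype RP] [DecidableEq RP] {kind : RP → PlaceKind}
    {lam : RP → ℂ} {hlam : ∀ b, lam b ≠ 0} {vac : RP → (Circle × Circle →* Circle)}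
    (A : PrintedAnalyticSide C D P RP kind lam hlam vac) :
    ∀ (Φ : SK) (i : SigIdx), (∃ v ∈ C.hatσ i, C.TΦ Φ v ≠ 0) → D.wOccurs i :=
  (PrintedOrbitSide.ofAnalytic A).H_occ

end Bridge

end ArchC

/-! ## §5  The model-level corollaries BY NAME -/

section Model

open HodgeCM.Prior.Perl34File HodgeCM.Prior.Perl34File.Perl34 HodgeCM.PerL34.ArchC

variable {U : Universe}

/-- **`Open_occ` (prl1 A10 = Thm 3.7's (†) = node N29) from D7-free charts in every good context**: per context and
torus side, a D7-free chart `O` over the context's core together with the [DEFINITIONAL] reading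
"eigen components have `wOccurs`" — the D7-free form of pv08-g3's `archC_binder_iff_core` right-hand side. -/
theorem _root_.HodgeCM.Universe.ThetaModel.Open_occ_of_orbitCores (T : U.ThetaModel)
    (Pc : ∀ {L : CMField} {ι₁ : L →+* ℂ} (V : HermSpace3 L ι₁) (c : SeesawCtx L),
      C4a.PointedCore (T.core V c))
    (O12 : ∀ {L : CMField} {ι₁ : L →+* ℂ} (V : HermSpace3 L ι₁) (c : SeesawCtx L), T.GoodCtx ι₁ c →
      ∃ O : OrbitCore (T.core V c) (Pc V c), ∀ i, O.Eigen i → (T.t12 V c).wOccurs i)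
    (O34 : ∀ {L : CMField} {ι₁ : L →+* ℂ} (V : HermSpace3 L ι₁) (c : SeesawCtx L), T.GoodCtx ι₁ c →
      ∃ O : OrbitCore (T.core V c) (Pc V c), ∀ i, O.Eigen i → (T.t34 V c).wOccurs i) :
    T.Open_occ := by
  intro L ι₁ V c hc
  exact ⟨occLeaf_of_exists_orbitCore (O12 V c hc), occLeaf_of_exists_orbitCore (O34 V c hc)⟩

/-- **`Open_occ` from D7-free Fock bridges in every good context** — pv12's `Open_occ_of_fockAnalyticBridges` with
the Gårding package no longer an input. -/
theorem Open_occ_of_fockOrbitBridges (T : U.ThetaModel)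
    (Pc : ∀ {L : CMField} {ι₁ : L →+* ℂ} (V : HermSpace3 L ι₁) (c : SeesawCtx L),
      C4a.PointedCore (T.core V c))
    (B12 : ∀ {L : CMField} {ι₁ : L →+* ℂ} (V : HermSpace3 L ι₁) (c : SeesawCtx L),
      T.GoodCtx ι₁ c → Nonempty (FockOrbitBridge (T.core V c) (T.t12 V c) (Pc V c)))
    (B34 : ∀ {L : CMField} {ι₁ : L →+* ℂ} (V : HermSpace3 L ι₁) (c : SeesawCtx L),
      T.GoodCtx ι₁ c → Nonempty (FockOrbitBridge (T.core V c) (T.t34 V c) (Pc V c))) :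
    T.Open_occ := by
  intro L ι₁ V c hc
  obtain ⟨a⟩ := B12 V c hc
  obtain ⟨b⟩ := B34 V c hc
  exact ⟨a.H_occ, b.H_occ⟩

/-- **N29 (= `Open_occ`) BY NAME from D7-free Fock bridges** (carver `N29_occ`). -/
theorem N29_occ_of_fockOrbitBridges (T : U.ThetaModel)
    (Pc : ∀ {L : CMField} {ι₁ : L →+* ℂ} (V : HermSpace3 L ι₁) (c : SeesawCtx L),
      C4a.PointedCore (T.core V c))
    (B12 : ∀ {L : CMField} {ι₁ : L →+* ℂ} (V : HermSpace3 L ι₁) (c : SeesawCtx L),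
      T.GoodCtx ι₁ c → Nonempty (FockOrbitBridge (T.core V c) (T.t12 V c) (Pc V c)))
    (B34 : ∀ {L : CMField} {ι₁ : L →+* ℂ} (V : HermSpace3 L ι₁) (c : SeesawCtx L),
      T.GoodCtx ι₁ c → Nonempty (FockOrbitBridge (T.core V c) (T.t34 V c) (Pc V c))) :
    N29_occ T :=
  (N29_iff T).mpr (Open_occ_of_fockOrbitBridges T Pc B12 B34)

/-- **The old bridge binders feed the new theorem** (forgetfully): pv12's input shape implies this file's. -/
theorem Open_occ_of_fockAnalyticBridges_viaOrbit (T : U.ThetaModel)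
    (Pc : ∀ {L : CMField} {ι₁ : L →+* ℂ} (V : HermSpace3 L ι₁) (c : SeesawCtx L),
      C4a.PointedCore (T.core V c))
    (B12 : ∀ {L : CMField} {ι₁ : L →+* ℂ} (V : HermSpace3 L ι₁) (c : SeesawCtx L),
      T.GoodCtx ι₁ c → Nonempty (FockAnalyticBridge (T.core V c) (T.t12 V c) (Pc V c)))
    (B34 : ∀ {L : CMField} {ι₁ : L →+* ℂ} (V : HermSpace3 L ι₁) (c : SeesawCtx L),
      T.GoodCtx ι₁ c → Nonempty (FockAnalyticBridge (T.core V c) (T.t34 V c) (Pc V c))) :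
    T.Open_occ :=
  Open_occ_of_fockOrbitBridges T Pc (fun V c hc => (B12 V c hc).map FockOrbitBridge.ofAnalytic)
    (fun V c hc => (B34 V c hc).map FockOrbitBridge.ofAnalytic)

end Model

end PerL34
end HodgeCM

end
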